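import Summits.QuantumFields.YangMills.Theorems.UnitScaleTiltProp7QprimeCombBumpSectionRows
import Summits.QuantumFields.YangMills.Theorems.UnitScaleTiltProp7AxialReprPrint
import Summits.QuantumFields.YangMills.Theorems.UnitScaleTiltProp7LandauCombDict
import Literature.MathematicalPhysics.QuantumFieldTheory.Balaban1983to89.B8Lemma1NonAbelian
import Literature.MathematicalPhysics.QuantumFieldTheory.Balaban1983to89.B9Thm31GpAgmonDecayCoarseZd
import HarnessLib

/-!
# Route `UnitScaleTilt`, crux K1 «MinimiserStabilityRegPr» (stmt-QuantumFields-19200) — route-R E′ (A′), LANE II «DIVERGENCE RECOVERY AT CURVED `W`» (★★OWNER RULING №23),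
# brick (B2a), FILE F5b: **THE ONE-SHOT AXIAL FRAME ROWS** — the frame `σ_W(x) := W♯(Γ_{ℓ·Y(x), x})` (parallel transport of the based pullback `W♯ = pull (bgUnits F K W) x₀` along
# the CORNER comb of the `ℓ`-box containing `x`, `ℓ = Lᵏ`, `k = K − n`, `Y(x) = ⌊x∕L⌋^[k]`; lit `B7Prop1Explicit.axialFn`, the gauge transformation to [Balaban1985Averaging] p. 24's
# axial gauge rooted at the box corner) IS (i) `N₀`-PERIODIC (`N₀ = (F.P K).sitesPerDir 0`, the period of the based pullback), (ii) `U1`-VALUED, and (iii) THIN ON IN-BOX BONDS at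
# every printed-regular background: `‖σ_W(z)·W♯(z,μ)·σ_W(z+e_μ)⁻¹ − 1‖ ≤ 4ε·η` whenever `z` and `z + e_μ` lie in the same `ℓ`-box and `W ∈ RegPr F n K ε` — the three HYPOTHESIS
# SLOTS `hσ` of ✓`Prop7QprimeCombBumpSection.exists_bumpSection` and `hσ`∕`hthin` of ✓`Prop7QprimeCombBumpSectionRows.norm_sq_DL2_section_le` (★p1 g19 LANE II NAMER WORD №6 (2)
# «THE FRAME LETTER `σ` IS FROZEN», WORD №7 (4) (B2a-F5b)), inhabited token for token.

Cell `ym3-torus` ∕ width seat `ym3-torus-px15` (gen 5).  THEOREMS ONLY (0 `def`, 0 `sorry`); `--supports stmt-QuantumFields-19200 --as helper`, count-neutral.  YM₃ on T³ is a ladder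
rung (R3) — NOT d = 4, NOT infinite volume, NOT a mass gap, NOT the Clay problem; nothing here claims (B2a), (REC), `hN06`, E′, EX, the crux or the gap.

THE PRINT.  [Balaban1985Averaging] p. 24: «Let us fix the point y … and define v₀(x) = V(Γ_{y,x}) … the gauge transformed configuration V₀ = V^{v₀} satisfies the conditions
V₀(Γ_{y,x}) = 1», p. 24 l. −2 – p. 25 l. 3: «V₀(x, x + e₁) = 1, |V₀(x, x + e₂) − 1| < |x₁ − y₁|α₀, …» (lit ✓`B8Lemma1NonAbelian.axial_bond_bound_sharp`: `‖V₀(x, x + e_μ) − 1‖ ≤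
(Σ_{κ<μ}|x_κ − y_κ|)·a` under `|V(∂p) − 1| ≤ a` on `[y, x + e_μ]`); [Balaban1985RegularSpaces] (1.7) p. 77 (the plaquette clause of the regular space, here through
`T3PrintedRegularMinimiser.RegPr` = [Balaban1985Variational] (2) p. 278: `|W(∂p) − 1| < ε·L^{−2k}` on the whole torus, hence on the whole cover `ℤ³` for `W♯` —
✓`Prop7AxialReprPrint.inAk_pull_of_regPr` ∘ ✓`pdev_pull_lt`).

WHAT IS PROVED (ns `…Theorems.Prop7OneShotAxialFrameRows`).  §1 (`ℤᵈ`, any group ∕ normed ring; lit letters `hol`∕`axialFn`∕`gaugeAct`∕`blockMap`∕`blockBase`):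
`exists_boxVec_of_blockMap_eq`∕`blockBase_blockMap_le` (a site lies above the corner of its box, by a `boxVec`; the dictionary `⌊·∕L⌋^[k] = ⌊·∕Lᵏ⌋` is lit
✓`blockMapIter_eq_iterate` ∘ ✓`blockMapIter_eq_blockMap_pow`, used inline), `blockBase_iterate_add_period` (the box corner is `N`-equivariant when `ℓ ∣ N`), `axialFn_add_period` (the corner-rooted frame of an
`N`-periodic field is `N`-periodic), ★ `norm_oneShotAxial_bond_sub_one_le` (THIN, `ℤᵈ` form: `‖σ(z)V(z,μ)σ(z+e_μ)⁻¹ − 1‖ ≤ (d−1)(ℓ−1)·pdev V` on in-box bonds, `U1`-valued `V`).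
§2 (member `F`, `n ≤ K`; the FROZEN letter written INLINE, no `def`): ★ `oneShotAxial_isPeriodic` (row (i)), `oneShotAxial_mem_U1` (row (ii)), ★★ `norm_oneShotAxial_bond_sub_one_le_of_regPr`
(row (iii) with `ϑ := 4ε`: `‖σ_W z · W♯ z μ · (σ_W (z + e μ))⁻¹ − 1‖ ≤ 4·ε·eta F n K` on `RegPr F n K ε W`, in-box bonds), and the packaged triple `oneShotAxial_rows_of_regPr`.
HONEST SCOPE.  Lattice bookkeeping + the lit bond bound by name; no estimate of print beyond [Balaban1985Averaging] pp. 24–25 as vendored; rung R3, not Clay; YM gap NOT proved.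

References: T. Bałaban, CMP **98** (1985) 17–51 [Balaban1985Averaging] (pp.24–25, (52)–(53) p.27); CMP **99** (1985) 75–102 [Balaban1985RegularSpaces] ((1.3), (1.7) p.77);
CMP **102** (1985) 277–309 [Balaban1985Variational] ((2) p.278); CMP **99** (1985) 389–434 [Balaban1985BackgroundPropagators] ((3.17)–(3.19) p.393).
-/

set_option autoImplicit false

noncomputable section

open scoped Matrix.Norms.L2Operator BigOperators

namespace Summit.QuantumFields.YangMills.Theorems.Prop7OneShotAxialFrameRows

open Literature.MathematicalPhysics.QuantumFieldTheory.Balaban1983to89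
open Literature.MathematicalPhysics.QuantumFieldTheory.Balaban1983to89.T3ContinuumYM3Torus
open Literature.MathematicalPhysics.QuantumLattice (blockMap blockBase blockSites mem_blockSites_iff blockMap_blockBase)
open B7Prop1Explicit renaming Site → LSite
open B7Prop1Explicit (U1 e e_apply Letter hol stepHol axialFn gaugeAct treeWord l1 boxVec hol_mem axialFn_mem)
open B7Prop2Explicit (pdev le_pdev pdev_nonneg)
open B8Lemma1NonAbelian (lowPart PlaqSmall axial_bond_bound_sharp l1_lowPart_boxVec_le)
open B9Eq325QprimeSingleSiteZd (blockMapIter_eq_blockMap_pow)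
open B9Thm31GpAgmonDecayCoarseZd (blockMapIter_eq_iterate)
open B10Eq27TorusAxialLog (transl pull pull_apply hol_pull)
open T4TermwiseTorus (IsPeriodic)
open T3SectALandauChart (bgUnits eta eta_pos pos_of_regPr)
open T3PrintedRegularMinimiser (RegPr)
open Summit.QuantumFields.YangMills.Theorems.Prop7SPrint (basePt)
open Summit.QuantumFields.YangMills.Theorems.Prop7QprimeCombL2 (sitesPerDir_zero_eq)
open Summit.QuantumFields.YangMills.Theorems.Prop7QprimeCombBumpSection (iterate_blockMap_add_period)
open Summit.QuantumFields.YangMills.Theorems.Prop7QprimeCombBumpSectionRows (pull_bgUnits_mem_U1)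
open Summit.QuantumFields.YangMills.Theorems.Prop7LandauCombDict (transl_add_period)
open Summit.QuantumFields.YangMills.Theorems.Prop7AxialReprPrint (inAk_pull_of_regPr pdev_pull_lt)

/-! ## §1 `ℤᵈ` bookkeeping: boxes, corners, periodicity of the corner-rooted frame, the thin bond bound -/

section Zd

variable {d : ℕ}

/-- A site lies in the box of its label: `⌊z∕ℓ⌋ = Y ⇒ z = ℓ·Y + t` with `t ∈ [0, ℓ)ᵈ` (a `boxVec`). [cite: Balaban1985Averaging, (52)–(53) p.27] -/
theorem exists_boxVec_of_blockMap_eq {ℓ : ℕ} [NeZero ℓ] {z Y : LSite d} (h : blockMap ℓ z = Y) :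
    ∃ r : Fin d → Fin ℓ, z = blockBase ℓ Y + boxVec ℓ r := by
  have hz : z ∈ blockSites ℓ Y := (mem_blockSites_iff ℓ Y z).2 h
  simp only [blockSites, Finset.mem_image, Fintype.mem_piFinset, Finset.mem_range] at hz
  obtain ⟨t, ht, htz⟩ := hz
  exact ⟨fun i => ⟨t i, ht i⟩, by rw [← htz]; rfl⟩

/-- The corner of the box of `z` lies below `z`: `ℓ·⌊z∕ℓ⌋ ≤ z`. [cite: Balaban1985Averaging, (52)–(53) p.27] -/
theorem blockBase_blockMap_le {ℓ : ℕ} [NeZero ℓ] (z : LSite d) : blockBase ℓ (blockMap ℓ z) ≤ z := by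
  obtain ⟨r, hr⟩ := exists_boxVec_of_blockMap_eq (rfl : blockMap ℓ z = blockMap ℓ z)
  intro i
  have hi := congrFun hr i
  simp only [Pi.add_apply, boxVec] at hi
  have h0 : (0 : ℤ) ≤ ((r i : ℕ) : ℤ) := by positivity
  linarith

/-- The box corner is equivariant under whole periods: `ℓ·⌊(x + (ℓP)·m)∕L⌋^[k] = ℓ·⌊x∕L⌋^[k] + (ℓP)·m` (`ℓ = Lᵏ`). [cite: Balaban1985RegularSpaces, p.77 («every block lattice divides T_η»)] -/
theorem blockBase_iterate_add_period (L : ℕ) [NeZero L] (k P : ℕ) (x m : LSite d) :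
    blockBase (L ^ k) ((blockMap L)^[k] (x + ((L ^ k * P : ℕ) : ℤ) • m)) = blockBase (L ^ k) ((blockMap L)^[k] x) + ((L ^ k * P : ℕ) : ℤ) • m := by
  rw [iterate_blockMap_add_period]
  funext i
  simp only [blockBase, Pi.add_apply, Pi.smul_apply, smul_eq_mul, Nat.cast_pow, Nat.cast_mul]
  ring

/-- One letter of parallel transport of an `N`-periodic field is `N`-periodic in the base point. [cite: Balaban1985Averaging, (9) p.18] -/
theorem stepHol_add_period {G : Type*} [Group G] {N : ℕ} (V : LSite d → Fin d → G) (hV : IsPeriodic N V) (m y : LSite d) (l : Letter d) :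
    stepHol V (y + (N : ℤ) • m) l = stepHol V y l := by
  have h1 : V (y + (N : ℤ) • m) = V y := hV y m
  have h2 : V (y + l.vec + (N : ℤ) • m) = V (y + l.vec) := hV (y + l.vec) m
  simp only [stepHol, add_right_comm y ((N : ℤ) • m) l.vec, h1, h2]

/-- **The corner-rooted axial frame of a periodic field is periodic**: if `V(z + N·m) = V(z)` then `V(Γ based at y + N·m) = V(Γ based at y)` for every word (parallel transport (9) is
translation covariant). [cite: Balaban1985Averaging, (9) p.18, p.24] -/
theorem hol_add_period {G : Type*} [Group G] {N : ℕ} (V : LSite d → Fin d → G) (hV : IsPeriodic N V) (m : LSite d) :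
    ∀ (y : LSite d) (w : List (Letter d)), hol V (y + (N : ℤ) • m) w = hol V y w
  | y, [] => by rw [B7Prop1Explicit.hol_nil, B7Prop1Explicit.hol_nil]
  | y, l :: w => by
    rw [B7Prop1Explicit.hol_cons, B7Prop1Explicit.hol_cons, stepHol_add_period V hV m y l, add_right_comm, hol_add_period V hV m (y + l.vec) w]

/-- `axialFn` of a periodic field is jointly periodic in root and argument. [cite: Balaban1985Averaging, p.24] -/
theorem axialFn_add_period {G : Type*} [Group G] {N : ℕ} (V : LSite d → Fin d → G) (hV : IsPeriodic N V) (y x m : LSite d) :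
    axialFn V (y + (N : ℤ) • m) (x + (N : ℤ) • m) = axialFn V y x := by
  simp only [axialFn]
  rw [show x + (N : ℤ) • m - (y + (N : ℤ) • m) = x - y by abel, hol_add_period V hV m]

variable {𝔸 : Type*} [NormedRing 𝔸] [NormOneClass 𝔸]

/-- ★ **THE THIN ROW, `ℤᵈ` FORM** ([Balaban1985Averaging] p.24 l.−2 – p.25 l.3 through lit ✓`axial_bond_bound_sharp`): for a `U1`-valued `V` and a bond `⟨z, z + e_μ⟩` whose endpoints lie in the
SAME `ℓ`-box (`⌊(z + e_μ)∕ℓ⌋ = ⌊z∕ℓ⌋`), the bond variable gauged by the corner-rooted axial frame of that box is within `(d − 1)(ℓ − 1)·pdev V` of `1`.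
[cite: Balaban1985Averaging, pp.24–25, (52) p.26] -/
theorem norm_oneShotAxial_bond_sub_one_le {ℓ : ℕ} [NeZero ℓ] (V : LSite d → Fin d → 𝔸ˣ) (hV : ∀ x κ, V x κ ∈ U1 𝔸) (z : LSite d) (μ : Fin d)
    (hbox : blockMap ℓ (z + e μ) = blockMap ℓ z) :
    ‖((axialFn V (blockBase ℓ (blockMap ℓ z)) z * V z μ * (axialFn V (blockBase ℓ (blockMap ℓ (z + e μ))) (z + e μ))⁻¹ : 𝔸ˣ) : 𝔸) - 1‖
      ≤ ((d : ℝ) - 1) * ((ℓ : ℝ) - 1) * pdev V := by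
  rw [hbox]
  set y : LSite d := blockBase ℓ (blockMap ℓ z) with hy
  obtain ⟨r, hr⟩ := exists_boxVec_of_blockMap_eq (rfl : blockMap ℓ z = blockMap ℓ z)
  rw [← hy] at hr
  have hyz : y ≤ z := by rw [hy]; exact blockBase_blockMap_le z
  -- plaquettes everywhere within `pdev V`
  have hP : PlaqSmall V y (z + e μ) (pdev V) := fun x κ κ' _ _ _ => le_pdev hV x κ κ'
  have hb := axial_bond_bound_sharp V hV hP y z μ le_rfl hyz le_rfl
  have hzy : z - y = boxVec ℓ r := by rw [hr]; abel
  rw [hzy] at hb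
  exact hb.trans (mul_le_mul_of_nonneg_right (l1_lowPart_boxVec_le μ r) (pdev_nonneg V))

end Zd

/-! ## §2 The member's one-shot axial frame `σ_W` (FROZEN letter, inline): periodic, `U1`-valued, thin on in-box bonds at a printed-regular `W` -/

section Member

variable (F : T3Family) (n K : ℕ)

/-- ★ **ROW (i) — PERIODICITY**: `σ_W(x) := W♯(Γ_{ℓ·Y(x), x})` is `N₀`-periodic, `N₀ = (F.P K).sitesPerDir 0 = ℓ·N_k` (✓`sitesPerDir_zero_eq`): the box corner is `N₀`-equivariant
(`blockBase_iterate_add_period`) and the based pullback is `N₀`-periodic (✓`isPeriodic_pull` ∕ ✓`transl_add_period` through ✓`hol_pull`).  The slot `hσ` of ✓`exists_bumpSection`.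
[cite: Balaban1985RegularSpaces, (1.3) p.77; Balaban1985Averaging, p.24] -/
theorem oneShotAxial_isPeriodic (hnK : n ≤ K) (W : GaugeField (F.P K) 0 (Matrix.specialUnitaryGroup (Fin 2) ℂ)) :
    IsPeriodic ((F.P K).sitesPerDir 0)
      (fun x => axialFn (pull (bgUnits F K W) (basePt F n K)) (blockBase ((F.P K).L ^ (K - n)) ((blockMap (F.P K).L)^[K - n] x)) x) := by
  haveI : NeZero (F.P K).L := ⟨by have h := F.hL.2; show F.L ≠ 0; omega⟩
  intro x m
  have hper : IsPeriodic ((F.P K).sitesPerDir 0) (pull (bgUnits F K W) (basePt F n K)) := fun z m' => by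
    funext μ; rw [pull_apply, pull_apply, transl_add_period]
  show axialFn _ (blockBase _ ((blockMap (F.P K).L)^[K - n] (x + (((F.P K).sitesPerDir 0 : ℕ) : ℤ) • m))) (x + (((F.P K).sitesPerDir 0 : ℕ) : ℤ) • m) = _
  conv_lhs => rw [sitesPerDir_zero_eq F n K hnK]
  rw [blockBase_iterate_add_period, ← sitesPerDir_zero_eq F n K hnK]
  exact axialFn_add_period _ hper _ _ _

/-- **ROW (ii) — `U1`-VALUED** (the based pullback is `U1`-valued, ✓`pull_bgUnits_mem_U1`; transports of `U1`-valued fields are `U1`-valued, lit ✓`axialFn_mem`).  The slot `hσ` of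
✓`norm_sq_DL2_section_le`. [cite: Balaban1985Averaging, (19) p.21, p.24] -/
theorem oneShotAxial_mem_U1 (W : GaugeField (F.P K) 0 (Matrix.specialUnitaryGroup (Fin 2) ℂ)) (x : LSite (F.P K).d) :
    axialFn (pull (bgUnits F K W) (basePt F n K)) (blockBase ((F.P K).L ^ (K - n)) ((blockMap (F.P K).L)^[K - n] x)) x ∈ U1 (Matrix (Fin 2) (Fin 2) ℂ) :=
  axialFn_mem (fun z μ => pull_bgUnits_mem_U1 W (basePt F n K) z μ) _ _

/-- `pdev W♯ ≤ 2ε·η²` at a printed-regular `W` (✓`inAk_pull_of_regPr` ∘ ✓`pdev_pull_lt`; `η = eta F n K = L^{−(K−n)}`). [cite: Balaban1985Variational, (2) p.278; Balaban1985RegularSpaces, (1.7) p.77] -/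
theorem pdev_pull_le_of_regPr {ε : ℝ} {W : GaugeField (F.P K) 0 (Matrix.specialUnitaryGroup (Fin 2) ℂ)} (hW : RegPr F n K ε W) :
    pdev (pull (bgUnits F K W) (basePt F n K)) ≤ 2 * ε * (eta F n K) ^ 2 := by
  have he : 0 < ε := pos_of_regPr F hW
  have h := pdev_pull_lt (P := F.P K) he (inAk_pull_of_regPr F (n := n) he.le hW) (basePt F n K)
  have hη : (((F.P K).L : ℝ) ^ (K - n))⁻¹ = eta F n K := by
    show ((F.L : ℝ) ^ (K - n))⁻¹ = ((F.L : ℝ)⁻¹) ^ (K - n); rw [inv_pow]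
  rw [hη] at h
  exact h.le

/-- ★★ **ROW (iii) — THE THIN ROW ON IN-BOX BONDS AT A PRINTED-REGULAR `W`** (`ϑ := 4ε`): whenever `z` and `z + e_μ` lie in the same `ℓ`-box,
`‖σ_W(z)·W♯(z,μ)·σ_W(z+e_μ)⁻¹ − 1‖ ≤ 4·ε·η` — `(d−1)(ℓ−1)·pdev W♯ ≤ 2(ℓ−1)·2εη² ≤ 4ε·η` at `d = 3` (`ℓη = 1`).  The slot `hthin` of ✓`norm_sq_DL2_section_le`, token for token.
[cite: Balaban1985Averaging, pp.24–25; Balaban1985RegularSpaces, Lemma 1 (1.25) p.79] -/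
theorem norm_oneShotAxial_bond_sub_one_le_of_regPr {ε : ℝ} {W : GaugeField (F.P K) 0 (Matrix.specialUnitaryGroup (Fin 2) ℂ)} (hW : RegPr F n K ε W)
    (z : LSite (F.P K).d) (μ : Fin (F.P K).d) (hbox : (blockMap (F.P K).L)^[K - n] (z + e μ) = (blockMap (F.P K).L)^[K - n] z) :
    ‖((axialFn (pull (bgUnits F K W) (basePt F n K)) (blockBase ((F.P K).L ^ (K - n)) ((blockMap (F.P K).L)^[K - n] z)) z
        * pull (bgUnits F K W) (basePt F n K) z μ
        * (axialFn (pull (bgUnits F K W) (basePt F n K)) (blockBase ((F.P K).L ^ (K - n)) ((blockMap (F.P K).L)^[K - n] (z + e μ))) (z + e μ))⁻¹ :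
          (Matrix (Fin 2) (Fin 2) ℂ)ˣ) : Matrix (Fin 2) (Fin 2) ℂ) - 1‖ ≤ 4 * ε * eta F n K := by
  haveI : NeZero (F.P K).L := ⟨by have h := F.hL.2; show F.L ≠ 0; omega⟩
  haveI : NeZero ((F.P K).L ^ (K - n)) := ⟨pow_ne_zero _ (NeZero.ne _)⟩
  have he : 0 < ε := pos_of_regPr F hW
  have hη : 0 < eta F n K := eta_pos F n K
  set V := pull (bgUnits F K W) (basePt F n K) with hV
  have hVU : ∀ x κ, V x κ ∈ U1 (Matrix (Fin 2) (Fin 2) ℂ) := fun x κ => pull_bgUnits_mem_U1 W (basePt F n K) x κ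
  -- `⌊·∕L⌋^[k] = ⌊·∕Lᵏ⌋` (lit ✓`blockMapIter_eq_iterate` ∘ ✓`blockMapIter_eq_blockMap_pow`)
  have hit : ∀ x : LSite (F.P K).d, (blockMap (F.P K).L)^[K - n] x = blockMap ((F.P K).L ^ (K - n)) x := fun x => by
    rw [← blockMapIter_eq_iterate (F.P K).L (K - n) x, blockMapIter_eq_blockMap_pow]
  rw [hit, hit] at hbox ⊢
  have h1 := norm_oneShotAxial_bond_sub_one_le V hVU z μ hbox
  have hpd : pdev V ≤ 2 * ε * (eta F n K) ^ 2 := pdev_pull_le_of_regPr F n K hW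
  have hd : (((F.P K).d : ℕ) : ℝ) = 3 := by exact_mod_cast T3Family.P_d F K
  -- `ℓ·η = 1`
  have hℓη : ((((F.P K).L ^ (K - n) : ℕ) : ℝ)) * eta F n K = 1 := by
    show (((F.L ^ (K - n) : ℕ) : ℝ)) * ((F.L : ℝ)⁻¹) ^ (K - n) = 1
    rw [Nat.cast_pow, ← mul_pow, mul_inv_cancel₀ (ne_of_gt ((by exact_mod_cast lt_trans zero_lt_one F.hL.2 : (0:ℝ) < F.L))), one_pow]
  have hℓ1 : (1 : ℝ) ≤ (((F.P K).L ^ (K - n) : ℕ) : ℝ) := by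
    exact_mod_cast Nat.one_le_pow _ _ (Nat.pos_of_ne_zero (NeZero.ne _))
  refine h1.trans ?_
  rw [hd]
  calc ((3 : ℝ) - 1) * (((((F.P K).L ^ (K - n) : ℕ) : ℝ)) - 1) * pdev V
      ≤ ((3 : ℝ) - 1) * (((((F.P K).L ^ (K - n) : ℕ) : ℝ)) - 1) * (2 * ε * (eta F n K) ^ 2) :=
        mul_le_mul_of_nonneg_left hpd (by nlinarith)
    _ = 4 * ε * eta F n K * ((((((F.P K).L ^ (K - n) : ℕ) : ℝ)) * eta F n K) - eta F n K) := by ring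
    _ = 4 * ε * eta F n K * (1 - eta F n K) := by rw [hℓη]
    _ ≤ 4 * ε * eta F n K := by nlinarith [mul_pos he hη]

/-- ★★ **THE THREE ROWS PACKAGED** — (i) periodicity, (ii) `U1`-valuedness, (iii) thinness `ϑ = 4ε` on in-box bonds — for the FROZEN frame letter of NAMER WORD №6 (2), at every
printed-regular `W`: exactly the frame hypotheses of ✓`exists_bumpSection` and ✓`norm_sq_DL2_section_le` (F5 instantiates `σ :=` the inline letter and `exact`s the components).
[cite: Balaban1985Averaging, pp.24–25; Balaban1985RegularSpaces, (1.3), (1.7) p.77; Balaban1985BackgroundPropagators, (3.19) p.393] -/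
theorem oneShotAxial_rows_of_regPr (hnK : n ≤ K) {ε : ℝ} {W : GaugeField (F.P K) 0 (Matrix.specialUnitaryGroup (Fin 2) ℂ)} (hW : RegPr F n K ε W) :
    IsPeriodic ((F.P K).sitesPerDir 0)
        (fun x => axialFn (pull (bgUnits F K W) (basePt F n K)) (blockBase ((F.P K).L ^ (K - n)) ((blockMap (F.P K).L)^[K - n] x)) x) ∧
      (∀ x : LSite (F.P K).d,
        axialFn (pull (bgUnits F K W) (basePt F n K)) (blockBase ((F.P K).L ^ (K - n)) ((blockMap (F.P K).L)^[K - n] x)) x ∈ U1 (Matrix (Fin 2) (Fin 2) ℂ)) ∧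
      (∀ (z : LSite (F.P K).d) (μ : Fin (F.P K).d), (blockMap (F.P K).L)^[K - n] (z + e μ) = (blockMap (F.P K).L)^[K - n] z →
        ‖((axialFn (pull (bgUnits F K W) (basePt F n K)) (blockBase ((F.P K).L ^ (K - n)) ((blockMap (F.P K).L)^[K - n] z)) z
            * pull (bgUnits F K W) (basePt F n K) z μ
            * (axialFn (pull (bgUnits F K W) (basePt F n K)) (blockBase ((F.P K).L ^ (K - n)) ((blockMap (F.P K).L)^[K - n] (z + e μ))) (z + e μ))⁻¹ :
              (Matrix (Fin 2) (Fin 2) ℂ)ˣ) : Matrix (Fin 2) (Fin 2) ℂ) - 1‖ ≤ (4 * ε) * eta F n K) :=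
  ⟨oneShotAxial_isPeriodic F n K hnK W, oneShotAxial_mem_U1 F n K W,
    fun z μ hbox => norm_oneShotAxial_bond_sub_one_le_of_regPr F n K hW z μ hbox⟩

end Member

end Summit.QuantumFields.YangMills.Theorems.Prop7OneShotAxialFrameRows

end
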